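import Summits.QuantumFields.YangMills.Theorems.LuscherReductionOneSiteLevelsValleyFar

/-!
# VALLEY, step 4b: the one-site action along a gnomonic kinetic step — the NEAR (second-order) algebra
# (support module for `stub_absUpperValleyMag` of crux `OneSiteLevels`, route `LuscherReduction`, item stmt-QuantumFields-20007;
# fleet lead prover ym-luscher-20007-p1 g2)

For the NEAR case of the VALLEY supersolution test the kinetic step `V = U·W` is parametrised by the all-upper gnomonic chart,
`W_i = P(1, y_i)`, `y ∈ ℝ⁹ = ZM`.  Then EXACTLY `v⃗_i = p_i (u⃗_i + M_i y_i)` with `p_i = (1+|y_i|²)^{-1/2}` and `M_i y = u_{i,0} y + u⃗_i × y`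
(`vecPart_mul_gnoPoint`), `|M_i y|² ≤ |y|²` (`dot_self_linkMap_le`), and `v⃗_i × v⃗_j = p_ip_j (c_{ij} + ℓ_{ij}(y) + q_{ij}(y))` with
`c_{ij} = u⃗_i × u⃗_j`, `ℓ_{ij}(y) = u⃗_i × M_jy_j + M_iy_i × u⃗_j` LINEAR, `q_{ij}(y) = M_iy_i × M_jy_j`.  Keeping the positive square `½|ℓ|²`
(`pair_near_ge`: `|c + ℓ + q|² ≥ |c|² + 2c·ℓ + 2c·q + ½|ℓ|² − |q|²`) and the chart weights `p_i²p_j² ∈ [1 − 2η, 1]` (`|y_i|² ≤ η`) gives the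
second-order lower bound for the action after the step (`wilsonAction_mul_gnChart_ge`):

  `S(U·W(y)) ≥ (1 − 6η) S(U) + G_U(y) + 4 Σ c·q + (1 − 12η) Q_U(y) − (2 + 12η) Σ|q|²`,

`G_U(y) = 4Σ c_{ij}·ℓ_{ij}(y)` (the gradient, linear), `Q_U(y) = Σ|ℓ_{ij}(y)|²` (the transverse Hessian, a sum of squares of linear forms),
together with the size bounds `|G_U(y)| ≤ 4√2 ρ√S ‖y‖`, `|Σ c·q| ≤ √(S/2)‖y‖²`, `Σ|q|² ≤ ‖y‖⁴`, `Q_U(y) ≤ 4ρ²‖y‖²`.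

## WHAT THIS IS NOT
Pure algebra; NOT the valley estimate, NOT the crux, NOT THE CLAY GAP.  Sorry-free; no new definition, no named fact.
-/

set_option autoImplicit false

noncomputable section

open MeasureTheory Filter Topology Real
open scoped Matrix Quaternion RealInnerProductSpace BigOperators
open Literature.MathematicalPhysics.QuantumFieldTheory
open Literature.MathematicalPhysics.QuantumLattice
open Literature.Analysis.OperatorTheory.YMMatrixModel
open Literature.MathematicalPhysics.QuantumFieldTheory.Balaban1983to89.T4CubeChartGnomonic (gnoPoint)

namespace Summit.QuantumFields.YangMills.Theorems.FemtoTransferGap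

/-! ### §1. The NEAR pair inequality and the weighted family inequality -/

/-- **NEAR pair inequality**: `|c + ℓ + q|² ≥ |c|² + 2c·ℓ + 2c·q + ½|ℓ|² − |q|²` (`2ℓ·q ≥ −½|ℓ|² − 2|q|²`). [folklore] -/
theorem dot_self_add_add_ge (c l q : Fin 3 → ℝ) :
    c ⬝ᵥ c + 2 * (c ⬝ᵥ l) + 2 * (c ⬝ᵥ q) + (1 / 2) * (l ⬝ᵥ l) - q ⬝ᵥ q ≤ (c + l + q) ⬝ᵥ (c + l + q) := by
  have e : (c + l + q) ⬝ᵥ (c + l + q) = c ⬝ᵥ c + l ⬝ᵥ l + q ⬝ᵥ q + 2 * (c ⬝ᵥ l) + 2 * (c ⬝ᵥ q) + 2 * (l ⬝ᵥ q) := by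
    simp only [add_dotProduct, dotProduct_add, dotProduct_comm l c, dotProduct_comm q c, dotProduct_comm q l]; ring
  have h0 : 0 ≤ (l + (2:ℝ) • q) ⬝ᵥ (l + (2:ℝ) • q) := Finset.sum_nonneg fun _ _ => mul_self_nonneg _
  have e2 : (l + (2:ℝ) • q) ⬝ᵥ (l + (2:ℝ) • q) = l ⬝ᵥ l + 4 * (l ⬝ᵥ q) + 4 * (q ⬝ᵥ q) := by
    simp only [add_dotProduct, dotProduct_add, dotProduct_smul, smul_dotProduct, smul_eq_mul, dotProduct_comm q l]; ring
  rw [e]; rw [e2] at h0; linarith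

/-- `|c + ℓ + q|² ≤ 3(|c|² + |ℓ|² + |q|²)`. [folklore] -/
theorem dot_self_add_add_le (c l q : Fin 3 → ℝ) :
    (c + l + q) ⬝ᵥ (c + l + q) ≤ 3 * (c ⬝ᵥ c + l ⬝ᵥ l + q ⬝ᵥ q) := by
  have e : (c + l + q) ⬝ᵥ (c + l + q) = c ⬝ᵥ c + l ⬝ᵥ l + q ⬝ᵥ q + 2 * (c ⬝ᵥ l) + 2 * (c ⬝ᵥ q) + 2 * (l ⬝ᵥ q) := by
    simp only [add_dotProduct, dotProduct_add, dotProduct_comm l c, dotProduct_comm q c, dotProduct_comm q l]; ring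
  have h1 : 0 ≤ (c - l) ⬝ᵥ (c - l) := Finset.sum_nonneg fun _ _ => mul_self_nonneg _
  have h2 : 0 ≤ (c - q) ⬝ᵥ (c - q) := Finset.sum_nonneg fun _ _ => mul_self_nonneg _
  have h3 : 0 ≤ (l - q) ⬝ᵥ (l - q) := Finset.sum_nonneg fun _ _ => mul_self_nonneg _
  have e1 : (c - l) ⬝ᵥ (c - l) = c ⬝ᵥ c - 2 * (c ⬝ᵥ l) + l ⬝ᵥ l := by
    simp only [sub_dotProduct, dotProduct_sub, dotProduct_comm l c]; ring
  have e2 : (c - q) ⬝ᵥ (c - q) = c ⬝ᵥ c - 2 * (c ⬝ᵥ q) + q ⬝ᵥ q := by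
    simp only [sub_dotProduct, dotProduct_sub, dotProduct_comm q c]; ring
  have e3 : (l - q) ⬝ᵥ (l - q) = l ⬝ᵥ l - 2 * (l ⬝ᵥ q) + q ⬝ᵥ q := by
    simp only [sub_dotProduct, dotProduct_sub, dotProduct_comm q l]; ring
  linarith [e1 ▸ h1, e2 ▸ h2, e3 ▸ h3]

/-- The pair decomposition `(x₁ + m₁) × (x₂ + m₂) = c + ℓ + q`. [folklore] -/
theorem cross_add_add (x₁ x₂ m₁ m₂ : Fin 3 → ℝ) :
    (x₁ + m₁) ⨯₃ (x₂ + m₂) = x₁ ⨯₃ x₂ + (x₁ ⨯₃ m₂ + m₁ ⨯₃ x₂) + m₁ ⨯₃ m₂ := by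
  simp only [map_add, LinearMap.add_apply]; abel

/-- **Weighted NEAR family inequality.**  For families `x, m : Fin 3 → ℝ³`, weights `w_p ∈ [1 − δ, 1]` (`δ ≥ 0`):
`2Σ_p w_p |(x+m)_{p.1} × (x+m)_{p.2}|² ≥ (1−3δ)·2Σ|c_p|² + 4Σ c_p·ℓ_p + 4Σ c_p·q_p + (1−6δ)Σ|ℓ_p|² − (2+6δ)Σ|q_p|²`. [folklore] -/
theorem sum_cross_weighted_ge (x m : Fin 3 → Fin 3 → ℝ) (w : Fin 3 × Fin 3 → ℝ) {δ : ℝ} (hδ : 0 ≤ δ)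
    (hw : ∀ p, 1 - δ ≤ w p ∧ w p ≤ 1) :
    (1 - 3 * δ) * (2 * ∑ p : Fin 3 × Fin 3, (x p.1 ⨯₃ x p.2) ⬝ᵥ (x p.1 ⨯₃ x p.2))
      + 4 * ∑ p : Fin 3 × Fin 3, (x p.1 ⨯₃ x p.2) ⬝ᵥ (x p.1 ⨯₃ m p.2 + m p.1 ⨯₃ x p.2)
      + 4 * ∑ p : Fin 3 × Fin 3, (x p.1 ⨯₃ x p.2) ⬝ᵥ (m p.1 ⨯₃ m p.2)
      + (1 - 6 * δ) * ∑ p : Fin 3 × Fin 3, (x p.1 ⨯₃ m p.2 + m p.1 ⨯₃ x p.2) ⬝ᵥ (x p.1 ⨯₃ m p.2 + m p.1 ⨯₃ x p.2)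
      - (2 + 6 * δ) * ∑ p : Fin 3 × Fin 3, (m p.1 ⨯₃ m p.2) ⬝ᵥ (m p.1 ⨯₃ m p.2)
      ≤ 2 * ∑ p : Fin 3 × Fin 3, w p * (((x p.1 + m p.1) ⨯₃ (x p.2 + m p.2)) ⬝ᵥ ((x p.1 + m p.1) ⨯₃ (x p.2 + m p.2))) := by
  have hp : ∀ p : Fin 3 × Fin 3,
      (1 - 3 * δ) * ((x p.1 ⨯₃ x p.2) ⬝ᵥ (x p.1 ⨯₃ x p.2))
        + 2 * ((x p.1 ⨯₃ x p.2) ⬝ᵥ (x p.1 ⨯₃ m p.2 + m p.1 ⨯₃ x p.2))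
        + 2 * ((x p.1 ⨯₃ x p.2) ⬝ᵥ (m p.1 ⨯₃ m p.2))
        + (1 - 6 * δ) / 2 * ((x p.1 ⨯₃ m p.2 + m p.1 ⨯₃ x p.2) ⬝ᵥ (x p.1 ⨯₃ m p.2 + m p.1 ⨯₃ x p.2))
        - (1 + 3 * δ) * ((m p.1 ⨯₃ m p.2) ⬝ᵥ (m p.1 ⨯₃ m p.2))
      ≤ w p * (((x p.1 + m p.1) ⨯₃ (x p.2 + m p.2)) ⬝ᵥ ((x p.1 + m p.1) ⨯₃ (x p.2 + m p.2))) := by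
    intro p
    rw [cross_add_add]
    set c := x p.1 ⨯₃ x p.2
    set l := x p.1 ⨯₃ m p.2 + m p.1 ⨯₃ x p.2
    set q := m p.1 ⨯₃ m p.2
    have hX0 : 0 ≤ (c + l + q) ⬝ᵥ (c + l + q) := Finset.sum_nonneg fun _ _ => mul_self_nonneg _
    have hlow := dot_self_add_add_ge c l q
    have hup := dot_self_add_add_le c l q
    have hc0 : 0 ≤ c ⬝ᵥ c := Finset.sum_nonneg fun _ _ => mul_self_nonneg _
    have hl0 : 0 ≤ l ⬝ᵥ l := Finset.sum_nonneg fun _ _ => mul_self_nonneg _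
    have hq0 : 0 ≤ q ⬝ᵥ q := Finset.sum_nonneg fun _ _ => mul_self_nonneg _
    -- `w X ≥ X − δ X` and `X ≤ 3(|c|² + |ℓ|² + |q|²)`
    have h1 : (1 - δ) * ((c + l + q) ⬝ᵥ (c + l + q)) ≤ w p * ((c + l + q) ⬝ᵥ (c + l + q)) :=
      mul_le_mul_of_nonneg_right (hw p).1 hX0
    nlinarith [mul_le_mul_of_nonneg_left hup hδ]
  have hsum := Finset.sum_le_sum fun p (_ : p ∈ (Finset.univ : Finset (Fin 3 × Fin 3))) => hp p
  have eL : (1 - 3 * δ) * (2 * ∑ p : Fin 3 × Fin 3, (x p.1 ⨯₃ x p.2) ⬝ᵥ (x p.1 ⨯₃ x p.2))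
      + 4 * ∑ p : Fin 3 × Fin 3, (x p.1 ⨯₃ x p.2) ⬝ᵥ (x p.1 ⨯₃ m p.2 + m p.1 ⨯₃ x p.2)
      + 4 * ∑ p : Fin 3 × Fin 3, (x p.1 ⨯₃ x p.2) ⬝ᵥ (m p.1 ⨯₃ m p.2)
      + (1 - 6 * δ) * ∑ p : Fin 3 × Fin 3, (x p.1 ⨯₃ m p.2 + m p.1 ⨯₃ x p.2) ⬝ᵥ (x p.1 ⨯₃ m p.2 + m p.1 ⨯₃ x p.2)
      - (2 + 6 * δ) * ∑ p : Fin 3 × Fin 3, (m p.1 ⨯₃ m p.2) ⬝ᵥ (m p.1 ⨯₃ m p.2)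
      = 2 * ∑ p : Fin 3 × Fin 3, ((1 - 3 * δ) * ((x p.1 ⨯₃ x p.2) ⬝ᵥ (x p.1 ⨯₃ x p.2))
        + 2 * ((x p.1 ⨯₃ x p.2) ⬝ᵥ (x p.1 ⨯₃ m p.2 + m p.1 ⨯₃ x p.2))
        + 2 * ((x p.1 ⨯₃ x p.2) ⬝ᵥ (m p.1 ⨯₃ m p.2))
        + (1 - 6 * δ) / 2 * ((x p.1 ⨯₃ m p.2 + m p.1 ⨯₃ x p.2) ⬝ᵥ (x p.1 ⨯₃ m p.2 + m p.1 ⨯₃ x p.2))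
        - (1 + 3 * δ) * ((m p.1 ⨯₃ m p.2) ⬝ᵥ (m p.1 ⨯₃ m p.2))) := by
    simp only [Finset.mul_sum]
    rw [← Finset.sum_add_distrib, ← Finset.sum_add_distrib, ← Finset.sum_add_distrib, ← Finset.sum_sub_distrib]
    exact Finset.sum_congr rfl fun p _ => by ring
  rw [eL, Finset.mul_sum, Finset.mul_sum]
  exact Finset.sum_le_sum fun p _ => by linarith [hp p]

/-! ### §2. The link map `M_U y = u₀ y + u⃗ × y` and the chart step -/

/-- `|u₀ y + u⃗ × y|² = |y|² − (u⃗·y)² ≤ |y|²` for a unit quaternion `(u₀, u⃗)`. [folklore] -/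
theorem dot_self_linkMap_le (U : SU2) (y : Fin 3 → ℝ) :
    (scalarPart U • y + vecPart U ⨯₃ y) ⬝ᵥ (scalarPart U • y + vecPart U ⨯₃ y) ≤ y ⬝ᵥ y := by
  have h1 := scalarPart_sq_add U
  rw [← vecPart_dot_self] at h1
  have e : (scalarPart U • y + vecPart U ⨯₃ y) ⬝ᵥ (scalarPart U • y + vecPart U ⨯₃ y)
      = scalarPart U ^ 2 * (y ⬝ᵥ y) + (vecPart U ⨯₃ y) ⬝ᵥ (vecPart U ⨯₃ y) := by
    have hz : y ⬝ᵥ (vecPart U ⨯₃ y) = 0 := dot_cross_self _ _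
    simp only [add_dotProduct, dotProduct_add, dotProduct_smul, smul_dotProduct, smul_eq_mul, dotProduct_comm (vecPart U ⨯₃ y) y, hz]
    ring
  rw [e, cross_dot_cross, dotProduct_comm y (vecPart U)]
  have h2 : scalarPart U ^ 2 * (y ⬝ᵥ y) + (vecPart U ⬝ᵥ vecPart U) * (y ⬝ᵥ y) = y ⬝ᵥ y := by rw [← add_mul, h1, one_mul]
  nlinarith [sq_nonneg (vecPart U ⬝ᵥ y), h2]

/-- **The vector part of a link after a gnomonic step**: `vecPart(U · P(1,v)) = ‖(1,v)‖⁻¹ · (u⃗ + u₀ v + u⃗ × v)`. [folklore] -/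
theorem vecPart_mul_gnoPoint (U : SU2) (v : Fin 3 → ℝ) :
    vecPart (U * gnoPoint v) = ‖gnomonicQuat v‖⁻¹ • (vecPart U + (scalarPart U • v + vecPart U ⨯₃ v)) := by
  rw [vecPart_mul, scalarPart_gnoPoint]
  have hv : vecPart (gnoPoint v) = ‖gnomonicQuat v‖⁻¹ • v := funext fun a => by rw [Pi.smul_apply, smul_eq_mul, vecPart_gnoPoint]
  rw [hv, map_smul, smul_smul, mul_comm (scalarPart U), ← smul_smul, smul_add, smul_add]
  abel

/-- `(‖(1,v)‖⁻¹)² = (1 + |v|²)⁻¹`. [folklore] -/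
theorem inv_norm_gnomonicQuat_sq (v : Fin 3 → ℝ) : (‖gnomonicQuat v‖⁻¹) ^ 2 = (1 + vsq v)⁻¹ := by
  rw [inv_pow, norm_gnomonicQuat_sq]

/-- `1 − s ≤ (1 + s)⁻¹ ≤ 1` for `s ≥ 0`. [folklore] -/
theorem one_sub_le_inv_one_add {s : ℝ} (hs : 0 ≤ s) : 1 - s ≤ (1 + s)⁻¹ ∧ (1 + s)⁻¹ ≤ 1 := by
  have h1 : 0 < 1 + s := by linarith
  refine ⟨?_, inv_le_one_of_one_le₀ (by linarith)⟩
  rw [inv_eq_one_div, le_div_iff₀ h1]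
  nlinarith

/-- The chart weight of a pair: `1 − s_i − s_j ≤ p_i² p_j² ≤ 1` with `p = ‖(1,v)‖⁻¹`, `s = |v|²`. [folklore] -/
theorem chartWeight_bounds (v v' : Fin 3 → ℝ) :
    1 - vsq v - vsq v' ≤ (‖gnomonicQuat v‖⁻¹) ^ 2 * (‖gnomonicQuat v'‖⁻¹) ^ 2
      ∧ (‖gnomonicQuat v‖⁻¹) ^ 2 * (‖gnomonicQuat v'‖⁻¹) ^ 2 ≤ 1 := by
  rw [inv_norm_gnomonicQuat_sq, inv_norm_gnomonicQuat_sq]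
  have h0 := vsq_nonneg v
  have h0' := vsq_nonneg v'
  obtain ⟨ha, ha1⟩ := one_sub_le_inv_one_add h0
  obtain ⟨hb, hb1⟩ := one_sub_le_inv_one_add h0'
  have hap : 0 ≤ (1 + vsq v)⁻¹ := by positivity
  have hbp : 0 ≤ (1 + vsq v')⁻¹ := by positivity
  constructor
  · rcases le_or_gt 0 (1 - vsq v) with h | h
    · rcases le_or_gt 0 (1 - vsq v') with h' | h'
      · nlinarith [mul_le_mul ha hb h' hap]
      · nlinarith [mul_nonneg hap hbp]
    · nlinarith [mul_nonneg hap hbp]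
  · calc (1 + vsq v)⁻¹ * (1 + vsq v')⁻¹ ≤ 1 * 1 := mul_le_mul ha1 hb1 hbp zero_le_one
      _ = 1 := one_mul 1

/-! ### §3. The action after a gnomonic step: exact form and the second-order lower bound -/

/-- The all-upper chart link is the chart point of the colour vector: `(gnChart 1 σ₀ y)_i = P(1, y_i)`. [folklore] -/
theorem gnChart_upper_apply (y : ZM) (i : Fin 3) :
    gnChart 1 (fun _ => false) y (edgeOf i) = gnoPoint (colourVec y i) := by
  simp [gnChart, hemi, edgeOf]
  rfl

/-- **Colour vectors after the step**: `v⃗_i = p_i (u⃗_i + M_i y_i)`, `p_i = ‖(1,y_i)‖⁻¹`, `M_i y = u_{i,0} y + u⃗_i × y`. [folklore] -/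
theorem colourVec_zmCoord_mul_gnChart (U : Cfg) (y : ZM) (i : Fin 3) :
    colourVec (zmCoord 1 (U * gnChart 1 (fun _ => false) y)) i
      = ‖gnomonicQuat (colourVec y i)‖⁻¹ • (vecPart (U (edgeOf i))
        + (scalarPart (U (edgeOf i)) • colourVec y i + vecPart (U (edgeOf i)) ⨯₃ colourVec y i)) := by
  rw [colourVec_zmCoord_one, Pi.mul_apply, gnChart_upper_apply, vecPart_mul_gnoPoint]

/-- Cross products of scaled vectors: `(a x) × (b z) = (ab)(x × z)` and its square. [folklore] -/
theorem cross_smul_smul_dot (a b : ℝ) (x z : Fin 3 → ℝ) :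
    ((a • x) ⨯₃ (b • z)) ⬝ᵥ ((a • x) ⨯₃ (b • z)) = a ^ 2 * b ^ 2 * ((x ⨯₃ z) ⬝ᵥ (x ⨯₃ z)) := by
  rw [LinearMap.map_smul₂, LinearMap.map_smul, smul_smul, smul_dotProduct, dotProduct_smul, smul_eq_mul, smul_eq_mul]
  ring

/-- **The action after the step, exactly**: `S(U·W(y)) = 2 Σ_{(i,j)} p_i²p_j² |(u⃗_i + M_iy_i) × (u⃗_j + M_jy_j)|²`. [cite: Luscher1983, §2] -/
theorem wilsonAction_mul_gnChart_eq (U : Cfg) (y : ZM) :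
    wilsonAction su2Rep (U * gnChart 1 (fun _ => false) y) = 2 * ∑ p : Fin 3 × Fin 3,
      (‖gnomonicQuat (colourVec y p.1)‖⁻¹) ^ 2 * (‖gnomonicQuat (colourVec y p.2)‖⁻¹) ^ 2 *
        (((vecPart (U (edgeOf p.1)) + (scalarPart (U (edgeOf p.1)) • colourVec y p.1 + vecPart (U (edgeOf p.1)) ⨯₃ colourVec y p.1))
            ⨯₃ (vecPart (U (edgeOf p.2)) + (scalarPart (U (edgeOf p.2)) • colourVec y p.2 + vecPart (U (edgeOf p.2)) ⨯₃ colourVec y p.2)))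
          ⬝ᵥ ((vecPart (U (edgeOf p.1)) + (scalarPart (U (edgeOf p.1)) • colourVec y p.1 + vecPart (U (edgeOf p.1)) ⨯₃ colourVec y p.1))
            ⨯₃ (vecPart (U (edgeOf p.2)) + (scalarPart (U (edgeOf p.2)) • colourVec y p.2 + vecPart (U (edgeOf p.2)) ⨯₃ colourVec y p.2)))) := by
  rw [wilsonAction_eq_two_mul_sum_cross]
  congr 1
  refine Finset.sum_congr rfl fun p _ => ?_
  rw [colourVec_zmCoord_mul_gnChart, colourVec_zmCoord_mul_gnChart, cross_smul_smul_dot]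

/-- **Second-order lower bound for the action after a gnomonic step.**  If `|y_i|² ≤ η` for all `i` (`η ≥ 0`) then, with
`u⃗_i = vecPart U_i`, `m_i = M_i y_i`, `c_p = u⃗_{p.1} × u⃗_{p.2}`, `ℓ_p = u⃗_{p.1} × m_{p.2} + m_{p.1} × u⃗_{p.2}`, `q_p = m_{p.1} × m_{p.2}`:
`S(U·W(y)) ≥ (1−6η)S(U) + 4Σ c·ℓ + 4Σ c·q + (1−12η)Σ|ℓ|² − (2+12η)Σ|q|²`. [cite: Luscher1983, §2] [cite: SimonB1983DiscreteSpectrum, §2] -/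
theorem wilsonAction_mul_gnChart_ge (U : Cfg) (y : ZM) {η : ℝ} (hη : 0 ≤ η) (hy : ∀ i, vsq (colourVec y i) ≤ η) :
    (1 - 6 * η) * wilsonAction su2Rep U
      + 4 * ∑ p : Fin 3 × Fin 3, (vecPart (U (edgeOf p.1)) ⨯₃ vecPart (U (edgeOf p.2))) ⬝ᵥ
          (vecPart (U (edgeOf p.1)) ⨯₃ (scalarPart (U (edgeOf p.2)) • colourVec y p.2 + vecPart (U (edgeOf p.2)) ⨯₃ colourVec y p.2)
            + (scalarPart (U (edgeOf p.1)) • colourVec y p.1 + vecPart (U (edgeOf p.1)) ⨯₃ colourVec y p.1) ⨯₃ vecPart (U (edgeOf p.2)))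
      + 4 * ∑ p : Fin 3 × Fin 3, (vecPart (U (edgeOf p.1)) ⨯₃ vecPart (U (edgeOf p.2))) ⬝ᵥ
          ((scalarPart (U (edgeOf p.1)) • colourVec y p.1 + vecPart (U (edgeOf p.1)) ⨯₃ colourVec y p.1)
            ⨯₃ (scalarPart (U (edgeOf p.2)) • colourVec y p.2 + vecPart (U (edgeOf p.2)) ⨯₃ colourVec y p.2))
      + (1 - 12 * η) * ∑ p : Fin 3 × Fin 3,
          (vecPart (U (edgeOf p.1)) ⨯₃ (scalarPart (U (edgeOf p.2)) • colourVec y p.2 + vecPart (U (edgeOf p.2)) ⨯₃ colourVec y p.2)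
            + (scalarPart (U (edgeOf p.1)) • colourVec y p.1 + vecPart (U (edgeOf p.1)) ⨯₃ colourVec y p.1) ⨯₃ vecPart (U (edgeOf p.2)))
          ⬝ᵥ (vecPart (U (edgeOf p.1)) ⨯₃ (scalarPart (U (edgeOf p.2)) • colourVec y p.2 + vecPart (U (edgeOf p.2)) ⨯₃ colourVec y p.2)
            + (scalarPart (U (edgeOf p.1)) • colourVec y p.1 + vecPart (U (edgeOf p.1)) ⨯₃ colourVec y p.1) ⨯₃ vecPart (U (edgeOf p.2)))
      - (2 + 12 * η) * ∑ p : Fin 3 × Fin 3,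
          (((scalarPart (U (edgeOf p.1)) • colourVec y p.1 + vecPart (U (edgeOf p.1)) ⨯₃ colourVec y p.1)
            ⨯₃ (scalarPart (U (edgeOf p.2)) • colourVec y p.2 + vecPart (U (edgeOf p.2)) ⨯₃ colourVec y p.2)))
          ⬝ᵥ (((scalarPart (U (edgeOf p.1)) • colourVec y p.1 + vecPart (U (edgeOf p.1)) ⨯₃ colourVec y p.1)
            ⨯₃ (scalarPart (U (edgeOf p.2)) • colourVec y p.2 + vecPart (U (edgeOf p.2)) ⨯₃ colourVec y p.2)))
      ≤ wilsonAction su2Rep (U * gnChart 1 (fun _ => false) y) := by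
  set x : Fin 3 → Fin 3 → ℝ := fun i => vecPart (U (edgeOf i)) with hx
  set m : Fin 3 → Fin 3 → ℝ := fun i => scalarPart (U (edgeOf i)) • colourVec y i + vecPart (U (edgeOf i)) ⨯₃ colourVec y i with hm
  set w : Fin 3 × Fin 3 → ℝ := fun p => (‖gnomonicQuat (colourVec y p.1)‖⁻¹) ^ 2 * (‖gnomonicQuat (colourVec y p.2)‖⁻¹) ^ 2 with hw
  have hwb : ∀ p, 1 - 2 * η ≤ w p ∧ w p ≤ 1 := by
    intro p
    obtain ⟨h1, h2⟩ := chartWeight_bounds (colourVec y p.1) (colourVec y p.2)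
    exact ⟨by linarith [hy p.1, hy p.2], h2⟩
  have hS : wilsonAction su2Rep U = 2 * ∑ p : Fin 3 × Fin 3, (x p.1 ⨯₃ x p.2) ⬝ᵥ (x p.1 ⨯₃ x p.2) := by
    rw [wilsonAction_eq_two_mul_sum_cross]; simp only [colourVec_zmCoord_one, hx]
  have hSW : wilsonAction su2Rep (U * gnChart 1 (fun _ => false) y)
      = 2 * ∑ p : Fin 3 × Fin 3, w p * (((x p.1 + m p.1) ⨯₃ (x p.2 + m p.2)) ⬝ᵥ ((x p.1 + m p.1) ⨯₃ (x p.2 + m p.2))) := by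
    rw [wilsonAction_mul_gnChart_eq]
  have key := sum_cross_weighted_ge x m w (δ := 2 * η) (by linarith) hwb
  rw [← hSW, ← hS] at key
  have e1 : (1 - 3 * (2 * η)) = 1 - 6 * η := by ring
  have e2 : (1 - 6 * (2 * η)) = 1 - 12 * η := by ring
  have e3 : (2 + 6 * (2 * η)) = 2 + 12 * η := by ring
  rw [e1, e2, e3] at key
  exact key

/-! ### §4. Size bounds: `|m_i| ≤ |y_i|`, `|G| ≤ 4√2ρ√S‖y‖`, `|Σ c·q| ≤ √(S/2)‖y‖²`, `Σ|q|² ≤ ‖y‖⁴`, `Q ≤ 4ρ²‖y‖²` -/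

/-- `Σ_i |y_i|² = ‖y‖²` and `|m_i|² ≤ |y_i|²` packaged: `Σ_i √(m_i·m_i)² ≤ ‖y‖²`. [folklore] -/
theorem sum_dot_self_linkMap_le (U : Cfg) (y : ZM) :
    ∑ i : Fin 3, (scalarPart (U (edgeOf i)) • colourVec y i + vecPart (U (edgeOf i)) ⨯₃ colourVec y i) ⬝ᵥ
        (scalarPart (U (edgeOf i)) • colourVec y i + vecPart (U (edgeOf i)) ⨯₃ colourVec y i) ≤ ‖y‖ ^ 2 := by
  rw [norm_sq_eq_sum_csq]
  exact Finset.sum_le_sum fun i _ => dot_self_linkMap_le _ _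

/-- **Size bounds for the gradient, the mixed term, the quartic term and the Hessian** along a gnomonic step, in terms of
`ρ = ‖zmCoord 1 U‖`, `S = S(U)` and `‖y‖`. [folklore] -/
theorem step_size_bounds (U : Cfg) (y : ZM) :
    |∑ p : Fin 3 × Fin 3, (vecPart (U (edgeOf p.1)) ⨯₃ vecPart (U (edgeOf p.2))) ⬝ᵥ
          (vecPart (U (edgeOf p.1)) ⨯₃ (scalarPart (U (edgeOf p.2)) • colourVec y p.2 + vecPart (U (edgeOf p.2)) ⨯₃ colourVec y p.2)
            + (scalarPart (U (edgeOf p.1)) • colourVec y p.1 + vecPart (U (edgeOf p.1)) ⨯₃ colourVec y p.1) ⨯₃ vecPart (U (edgeOf p.2)))|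
        ≤ Real.sqrt 2 * ‖zmCoord 1 U‖ * √(wilsonAction su2Rep U) * ‖y‖
    ∧ |∑ p : Fin 3 × Fin 3, (vecPart (U (edgeOf p.1)) ⨯₃ vecPart (U (edgeOf p.2))) ⬝ᵥ
          ((scalarPart (U (edgeOf p.1)) • colourVec y p.1 + vecPart (U (edgeOf p.1)) ⨯₃ colourVec y p.1)
            ⨯₃ (scalarPart (U (edgeOf p.2)) • colourVec y p.2 + vecPart (U (edgeOf p.2)) ⨯₃ colourVec y p.2))|
        ≤ √(wilsonAction su2Rep U / 2) * ‖y‖ ^ 2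
    ∧ ∑ p : Fin 3 × Fin 3,
          (((scalarPart (U (edgeOf p.1)) • colourVec y p.1 + vecPart (U (edgeOf p.1)) ⨯₃ colourVec y p.1)
            ⨯₃ (scalarPart (U (edgeOf p.2)) • colourVec y p.2 + vecPart (U (edgeOf p.2)) ⨯₃ colourVec y p.2)))
          ⬝ᵥ (((scalarPart (U (edgeOf p.1)) • colourVec y p.1 + vecPart (U (edgeOf p.1)) ⨯₃ colourVec y p.1)
            ⨯₃ (scalarPart (U (edgeOf p.2)) • colourVec y p.2 + vecPart (U (edgeOf p.2)) ⨯₃ colourVec y p.2)))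
        ≤ ‖y‖ ^ 4
    ∧ ∑ p : Fin 3 × Fin 3,
          (vecPart (U (edgeOf p.1)) ⨯₃ (scalarPart (U (edgeOf p.2)) • colourVec y p.2 + vecPart (U (edgeOf p.2)) ⨯₃ colourVec y p.2)
            + (scalarPart (U (edgeOf p.1)) • colourVec y p.1 + vecPart (U (edgeOf p.1)) ⨯₃ colourVec y p.1) ⨯₃ vecPart (U (edgeOf p.2)))
          ⬝ᵥ (vecPart (U (edgeOf p.1)) ⨯₃ (scalarPart (U (edgeOf p.2)) • colourVec y p.2 + vecPart (U (edgeOf p.2)) ⨯₃ colourVec y p.2)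
            + (scalarPart (U (edgeOf p.1)) • colourVec y p.1 + vecPart (U (edgeOf p.1)) ⨯₃ colourVec y p.1) ⨯₃ vecPart (U (edgeOf p.2)))
        ≤ 4 * ‖zmCoord 1 U‖ ^ 2 * ‖y‖ ^ 2 := by
  -- names
  obtain ⟨x, hx⟩ : ∃ x : Fin 3 → Fin 3 → ℝ, x = fun i => vecPart (U (edgeOf i)) := ⟨_, rfl⟩
  obtain ⟨m, hm⟩ : ∃ m : Fin 3 → Fin 3 → ℝ,
      m = fun i => scalarPart (U (edgeOf i)) • colourVec y i + vecPart (U (edgeOf i)) ⨯₃ colourVec y i := ⟨_, rfl⟩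
  have hxi : ∀ i, vecPart (U (edgeOf i)) = x i := fun i => by rw [hx]
  have hmi : ∀ i, scalarPart (U (edgeOf i)) • colourVec y i + vecPart (U (edgeOf i)) ⨯₃ colourVec y i = m i := fun i => by rw [hm]
  simp only [hmi]
  simp only [hxi]
  -- norms
  set nx : Fin 3 → ℝ := fun i => √(x i ⬝ᵥ x i) with hnx
  set na : Fin 3 → ℝ := fun i => √(m i ⬝ᵥ m i) with hna
  set nc : Fin 3 × Fin 3 → ℝ := fun p => √((x p.1 ⨯₃ x p.2) ⬝ᵥ (x p.1 ⨯₃ x p.2)) with hnc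
  have hnx0 : ∀ i, 0 ≤ nx i := fun i => Real.sqrt_nonneg _
  have hna0 : ∀ i, 0 ≤ na i := fun i => Real.sqrt_nonneg _
  have hnc0 : ∀ p, 0 ≤ nc p := fun p => Real.sqrt_nonneg _
  have hnx2 : ∀ i, nx i ^ 2 = x i ⬝ᵥ x i := fun i => Real.sq_sqrt (Finset.sum_nonneg fun _ _ => mul_self_nonneg _)
  have hna2 : ∀ i, na i ^ 2 = m i ⬝ᵥ m i := fun i => Real.sq_sqrt (Finset.sum_nonneg fun _ _ => mul_self_nonneg _)
  have hnc2 : ∀ p, nc p ^ 2 = (x p.1 ⨯₃ x p.2) ⬝ᵥ (x p.1 ⨯₃ x p.2) := fun p => Real.sq_sqrt (Finset.sum_nonneg fun _ _ => mul_self_nonneg _)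
  obtain ⟨S, hS⟩ : ∃ S : ℝ, S = wilsonAction su2Rep U := ⟨_, rfl⟩
  have hS0 : 0 ≤ S := by rw [hS]; exact wilsonAction_su2_nonneg U
  rw [← hS]
  have hSsum : ∑ p : Fin 3 × Fin 3, nc p ^ 2 = S / 2 := by
    simp only [hnc2]; rw [hS, wilsonAction_eq_two_mul_sum_cross]; simp only [colourVec_zmCoord_one, hxi]; ring
  have hρ2 : ‖zmCoord 1 U‖ ^ 2 = ∑ i, nx i ^ 2 := by
    rw [norm_zmCoord_sq_eq_sum_dot]; simp only [colourVec_zmCoord_one, hxi, hnx2]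
  have hρ0 : 0 ≤ ‖zmCoord 1 U‖ := norm_nonneg _
  have hρ' : √(∑ i, nx i ^ 2) = ‖zmCoord 1 U‖ := by rw [← hρ2, Real.sqrt_sq hρ0]
  have hA : ∑ i, na i ^ 2 ≤ ‖y‖ ^ 2 := by
    simp only [hna2]; have := sum_dot_self_linkMap_le U y; simp only [hmi] at this; exact this
  have hA0 : 0 ≤ ∑ i, na i ^ 2 := Finset.sum_nonneg fun _ _ => sq_nonneg _
  have hy0 : 0 ≤ ‖y‖ := norm_nonneg _
  have hAs : √(∑ i, na i ^ 2) ≤ ‖y‖ := by rw [← Real.sqrt_sq hy0]; exact Real.sqrt_le_sqrt hA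
  have hcS : √(∑ p : Fin 3 × Fin 3, nc p ^ 2) = √(S / 2) := by rw [hSsum]
  refine ⟨?_, ?_, ?_, ?_⟩
  · -- gradient: |Σ c·ℓ| ≤ Σ nc (nx na + na nx) ≤ √(S/2)(ρ√A + √Aρ) ≤ √2 ρ √S ‖y‖
    have h1 : |∑ p : Fin 3 × Fin 3, (x p.1 ⨯₃ x p.2) ⬝ᵥ (x p.1 ⨯₃ m p.2 + m p.1 ⨯₃ x p.2)|
        ≤ ∑ p : Fin 3 × Fin 3, nc p * (nx p.1 * na p.2) + ∑ p : Fin 3 × Fin 3, nc p * (na p.1 * nx p.2) := by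
      rw [← Finset.sum_add_distrib]
      refine (Finset.abs_sum_le_sum_abs _ _).trans (Finset.sum_le_sum fun p _ => ?_)
      refine (abs_dot_le_sqrt_mul_sqrt _ _).trans ?_
      rw [← mul_add]
      refine mul_le_mul_of_nonneg_left ?_ (hnc0 p)
      calc √((x p.1 ⨯₃ m p.2 + m p.1 ⨯₃ x p.2) ⬝ᵥ (x p.1 ⨯₃ m p.2 + m p.1 ⨯₃ x p.2))
          ≤ √((x p.1 ⨯₃ m p.2) ⬝ᵥ (x p.1 ⨯₃ m p.2)) + √((m p.1 ⨯₃ x p.2) ⬝ᵥ (m p.1 ⨯₃ x p.2)) := sqrt_dot_self_add_le _ _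
        _ ≤ nx p.1 * na p.2 + na p.1 * nx p.2 := add_le_add (sqrt_cross_dot_self_le _ _) (sqrt_cross_dot_self_le _ _)
    have cs1 := sum_pairs_mul_le nc nx na
    have cs2 := sum_pairs_mul_le nc na nx
    rw [hcS, hρ'] at cs1 cs2
    have hsq2 : √(S / 2) = √S / Real.sqrt 2 := by rw [Real.sqrt_div hS0]
    have hs2 : (0:ℝ) < Real.sqrt 2 := by positivity
    have hs22 : Real.sqrt 2 * Real.sqrt 2 = 2 := Real.mul_self_sqrt (by norm_num)
    have hm1 : √(S / 2) * (‖zmCoord 1 U‖ * √(∑ i, na i ^ 2)) ≤ √(S / 2) * (‖zmCoord 1 U‖ * ‖y‖) :=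
      mul_le_mul_of_nonneg_left (mul_le_mul_of_nonneg_left hAs hρ0) (Real.sqrt_nonneg _)
    have hm2 : √(S / 2) * (√(∑ i, na i ^ 2) * ‖zmCoord 1 U‖) ≤ √(S / 2) * (‖y‖ * ‖zmCoord 1 U‖) :=
      mul_le_mul_of_nonneg_left (mul_le_mul_of_nonneg_right hAs hρ0) (Real.sqrt_nonneg _)
    have e : √(S / 2) * (‖zmCoord 1 U‖ * ‖y‖) + √(S / 2) * (‖y‖ * ‖zmCoord 1 U‖)
        = Real.sqrt 2 * ‖zmCoord 1 U‖ * √S * ‖y‖ := by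
      have hsq' : √(S / 2) = Real.sqrt 2 * √S / 2 := by
        rw [hsq2]; field_simp; rw [Real.sq_sqrt (by norm_num : (0:ℝ) ≤ 2)]
      rw [hsq']; ring
    linarith [h1, cs1, cs2, hm1, hm2, e]
  · -- mixed: |Σ c·q| ≤ √(Σ nc²) √(Σ (na na)²) ≤ √(S/2) A ≤ √(S/2) ‖y‖²
    have h1 : |∑ p : Fin 3 × Fin 3, (x p.1 ⨯₃ x p.2) ⬝ᵥ (m p.1 ⨯₃ m p.2)| ≤ ∑ p : Fin 3 × Fin 3, nc p * (na p.1 * na p.2) := by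
      refine (Finset.abs_sum_le_sum_abs _ _).trans (Finset.sum_le_sum fun p _ => ?_)
      exact (abs_dot_le_sqrt_mul_sqrt _ _).trans (mul_le_mul_of_nonneg_left (sqrt_cross_dot_self_le _ _) (hnc0 p))
    have cs3 := sum_pairs_mul_le nc na na
    rw [hcS, Real.mul_self_sqrt hA0] at cs3
    have hm3 : √(S / 2) * (∑ i, na i ^ 2) ≤ √(S / 2) * ‖y‖ ^ 2 := mul_le_mul_of_nonneg_left hA (Real.sqrt_nonneg _)
    linarith
  · -- quartic: Σ |q|² ≤ Σ na² na² = A² ≤ ‖y‖⁴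
    calc ∑ p : Fin 3 × Fin 3, (m p.1 ⨯₃ m p.2) ⬝ᵥ (m p.1 ⨯₃ m p.2)
        ≤ ∑ p : Fin 3 × Fin 3, na p.1 ^ 2 * na p.2 ^ 2 := Finset.sum_le_sum fun p _ => by
          have h := sqrt_cross_dot_self_le (m p.1) (m p.2)
          have h0 : 0 ≤ (m p.1 ⨯₃ m p.2) ⬝ᵥ (m p.1 ⨯₃ m p.2) := Finset.sum_nonneg fun _ _ => mul_self_nonneg _
          have h1 := pow_le_pow_left₀ (Real.sqrt_nonneg _) h 2
          rw [Real.sq_sqrt h0, mul_pow] at h1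
          exact h1
      _ = (∑ i, na i ^ 2) * (∑ i, na i ^ 2) := by rw [Fintype.sum_mul_sum, Fintype.sum_prod_type]
      _ ≤ ‖y‖ ^ 2 * ‖y‖ ^ 2 := mul_le_mul hA hA hA0 (sq_nonneg _)
      _ = ‖y‖ ^ 4 := by ring
  · -- Hessian: Σ|ℓ|² ≤ Σ (nx na + na nx)² ≤ 2Σ(nx² na² + na² nx²) = 4 ρ² A ≤ 4ρ²‖y‖²
    calc ∑ p : Fin 3 × Fin 3, (x p.1 ⨯₃ m p.2 + m p.1 ⨯₃ x p.2) ⬝ᵥ (x p.1 ⨯₃ m p.2 + m p.1 ⨯₃ x p.2)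
        ≤ ∑ p : Fin 3 × Fin 3, (2 * (nx p.1 ^ 2 * na p.2 ^ 2) + 2 * (na p.1 ^ 2 * nx p.2 ^ 2)) :=
          Finset.sum_le_sum fun p _ => by
            have h1 := sqrt_dot_self_add_le (x p.1 ⨯₃ m p.2) (m p.1 ⨯₃ x p.2)
            have h2 := sqrt_cross_dot_self_le (x p.1) (m p.2)
            have h3 := sqrt_cross_dot_self_le (m p.1) (x p.2)
            have h0 : 0 ≤ (x p.1 ⨯₃ m p.2 + m p.1 ⨯₃ x p.2) ⬝ᵥ (x p.1 ⨯₃ m p.2 + m p.1 ⨯₃ x p.2) :=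
              Finset.sum_nonneg fun _ _ => mul_self_nonneg _
            have h4 : √((x p.1 ⨯₃ m p.2 + m p.1 ⨯₃ x p.2) ⬝ᵥ (x p.1 ⨯₃ m p.2 + m p.1 ⨯₃ x p.2))
                ≤ nx p.1 * na p.2 + na p.1 * nx p.2 := by
              refine h1.trans (add_le_add (h2.trans (le_of_eq rfl)) (h3.trans (le_of_eq rfl)))
            have h5 := Real.sq_sqrt h0
            have h6 : 0 ≤ nx p.1 * na p.2 + na p.1 * nx p.2 := by positivity
            have h7 := pow_le_pow_left₀ (Real.sqrt_nonneg _) h4 2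
            rw [h5] at h7
            nlinarith [sq_nonneg (nx p.1 * na p.2 - na p.1 * nx p.2)]
      _ = 4 * ((∑ i, nx i ^ 2) * (∑ i, na i ^ 2)) := by
          have e1 : ∑ p : Fin 3 × Fin 3, na p.1 ^ 2 * nx p.2 ^ 2 = ∑ p : Fin 3 × Fin 3, nx p.1 ^ 2 * na p.2 ^ 2 := by
            rw [Fintype.sum_prod_type, Fintype.sum_prod_type, Finset.sum_comm]
            exact Finset.sum_congr rfl fun i _ => Finset.sum_congr rfl fun j _ => by ring
          have e2 : (∑ i, nx i ^ 2) * (∑ i, na i ^ 2) = ∑ p : Fin 3 × Fin 3, nx p.1 ^ 2 * na p.2 ^ 2 := by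
            rw [Fintype.sum_mul_sum, Fintype.sum_prod_type]
          rw [Finset.sum_add_distrib, ← Finset.mul_sum, ← Finset.mul_sum, e1, e2]; ring
      _ ≤ 4 * ‖zmCoord 1 U‖ ^ 2 * ‖y‖ ^ 2 := by
          rw [← hρ2]; nlinarith [mul_le_mul_of_nonneg_left hA (sq_nonneg ‖zmCoord 1 U‖)]

end Summit.QuantumFields.YangMills.Theorems.FemtoTransferGap

end
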